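import Summits.NavierStokesRegularity.OSWSelfSimilar.SheetNSLineTorusCascade
import HarnessLib

/-!
# Viscous CLM on the torus (`a = 0`, `σ = 2`), global side of the sine-datum cascade: every mode decays individually,
# and `c < 2eν` ⇒ the Wiener norm stays bounded and decays (`Σ_k c_k(t) ≤ 2eνc·e^{−νt}/(2eν − c)`)

HONEST FRAMING (cell ns-blowup GROUP B «PROFILE SEARCH», zone Z3, row Z3-U addendum A-F2 of `HOME/profile/z3/CENSUS-Z3.md`;
human rulings D-0035/D-0074): **1-D MODEL (viscous Constantin–Lax–Majda equation `ω_t = ω Hω + ν ω_xx` on `𝕋 = ℝ/2πℤ`);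
ODE calculus on Fourier-coefficient families, kernel-checked; not Euler, not Navier–Stokes; «violates: none — MODEL».**

OBJECT: the sine-datum cascade `IsSineCascade ν c e` of the companion file `SheetNSLineTorusCascade` (coefficients `c_k(t)` of
the analytic signal `z = Hω − iω` for `ω₀ = −c sin x`; `ċ_k = ½ Σ_{i+j=k} c_i c_j − ν k² c_k`). There the pole SUB-solution gave
blow-up for `c ≥ 48ν`. HERE a SUPER-solution: the `σ = 1` cascade (`ν k²` replaced by `ν k`) is solved in closed form by
characteristics, `c^k (t/2)^{k−1} e^{−νkt}` (generating function `c w e^{−νt}/(1 − ½ c t w e^{−νt})`), and dominates (C) because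
`ν k ≤ ν k²`:

* `mode_le_sigmaOne` — **`c_k(t) ≤ c^k (t/2)^{k−1} e^{−νkt}` for every `k ≥ 1`, `t ≥ 0`** (strong induction; `e^{νk²t}(ẽ_k − c_k)`
  is non-decreasing);
* `tendsto_mode_zero` — **every single mode tends to `0` as `t → ∞`, for EVERY `c ≥ 0`**: on `𝕋` blow-up (companion file,
  `c ≥ 48ν`) is a loss of summability of the coefficient sequence — the analyticity radius reaching the unit circle — never
  the growth of a mode (MODEL reading of the Z3-U corner runs: «Schochet SHAPE, torus CLOCK»);
* `partialSum_le` — **if `c < 2eν` then for all `K`, `t ≥ 0`: `Σ_{k ≤ K} c_k(t) ≤ (2eνc/(2eν − c))·e^{−νt}`** — a uniform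
  Wiener-norm (`B₀`) bound decaying at the rate of the first mode; print has global existence for `‖ω₀‖_{B₀} < ν/4`
  [cite: SilantyevLushnikovSiegelAmbrose2025, Thm 2.2] (any `σ > 0`), here the explicit constant `2e ≈ 5.44` for sine data at
  `σ = 2`; the located threshold is `≈ 19.8ν` (cascade numerics, `HOME/profile/z3/SHEET.md` §15), between `2eν` and `48ν`.
READING (pen): with the standard continuation criterion in `B₀` [cite: AmbroseLushnikovSiegelSilantyev2024, §3], the bound of
`partialSum_le` is the a-priori estimate that makes the `B₀` solution from `ω₀ = −c sin x`, `c < 2eν`, global and decaying.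
bears_on: LADDER-NS N5 / zone Z3 (row Z3-U) → N1 linear core. WHAT THIS IS NOT: not NS; no PDE object constructed; not the
threshold value. No definitions.
-/

namespace Summit.NavierStokesRegularity.OSWSelfSimilar
namespace SheetNSLineTorusCascade

open Finset Real Set Filter Topology

variable {ν c : ℝ} {e : ℕ → ℝ → ℝ}

/-- The convolution driving mode `k ≥ 2`, with the two vanishing end terms removed:
`Σ_{i+j=k} e_i e_j = Σ_{j < k−1} e_{j+1} e_{k−1−j}`. [new here — MODEL] -/
theorem conv_eq_inner_sum (he : IsSineCascade ν c e) {k : ℕ} (hk : 2 ≤ k) (t : ℝ) :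
    ∑ p ∈ antidiagonal k, e p.1 t * e p.2 t = ∑ j ∈ range (k - 1), e (j + 1) t * e (k - 1 - j) t := by
  rw [Nat.sum_antidiagonal_eq_sum_range_succ (fun i j => e i t * e j t) k]
  obtain ⟨m, rfl⟩ : ∃ m, k = m + 2 := ⟨k - 2, by omega⟩
  show ∑ x ∈ range (m + 2 + 1), e x t * e (m + 2 - x) t = ∑ j ∈ range (m + 2 - 1), e (j + 1) t * e (m + 2 - 1 - j) t
  rw [show m + 2 - 1 = m + 1 from rfl, sum_range_succ, sum_range_succ', he.zero, zero_mul, add_zero, Nat.sub_self,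
    he.zero, mul_zero, add_zero]
  refine sum_congr rfl fun j _ => ?_
  have h3 : m + 2 - (j + 1) = m + 1 - j := by omega
  rw [h3]

/-- **THE `σ = 1` SUPER-SOLUTION.** For the sine-datum cascade with `ν ≥ 0`, `c ≥ 0`: every mode is dominated by the closed-form
solution of the `σ = 1` cascade, `c_k(t) ≤ c^k (t/2)^{k−1} e^{−νkt}` (`k ≥ 1`, `t ≥ 0`). [new here — MODEL] -/
theorem mode_le_sigmaOne (he : IsSineCascade ν c e) (hν : 0 ≤ ν) (hc : 0 ≤ c) :
    ∀ k : ℕ, 1 ≤ k → ∀ t : ℝ, 0 ≤ t → e k t ≤ c ^ k * (t / 2) ^ (k - 1) * exp (-(ν * (k : ℝ) * t)) := by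
  intro k
  induction k using Nat.strong_induction_on with
  | _ k ih =>
    intro hk t ht
    rcases Nat.lt_or_ge k 2 with hk1 | hk2
    · -- k = 1: equality
      have hk1' : k = 1 := by omega
      subst hk1'
      rw [mode_one he t ht]
      simp
    · -- k ≥ 2: ψ(s) = W(s) − D(s), W(s) = c^k (s/2)^{k−1} e^{ν(k²−k)s}, D(s) = e^{νk²s} e_k(s), is non-decreasing on [0,∞)
      obtain ⟨m, rfl⟩ : ∃ m, k = m + 2 := ⟨k - 2, by omega⟩
      have hm1 : (m + 2 : ℕ) - 1 = m + 1 := rfl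
      rw [hm1]
      set W : ℝ → ℝ := fun s => c ^ (m + 2) * (s / 2) ^ (m + 1) * exp (ν * (((m + 2 : ℕ) : ℝ) ^ 2 - (m + 2 : ℕ)) * s)
        with hW
      set X : ℝ → ℝ := fun s => c ^ (m + 2) * (s / 2) ^ m * exp (ν * (((m + 2 : ℕ) : ℝ) ^ 2 - (m + 2 : ℕ)) * s)
        with hX
      -- derivative of W
      have hW' : ∀ s, HasDerivAt W
          (c ^ (m + 2) * (((m + 1 : ℕ) : ℝ) * (s / 2) ^ m * (1 / 2))
              * exp (ν * (((m + 2 : ℕ) : ℝ) ^ 2 - (m + 2 : ℕ)) * s)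
            + c ^ (m + 2) * (s / 2) ^ (m + 1)
              * (exp (ν * (((m + 2 : ℕ) : ℝ) ^ 2 - (m + 2 : ℕ)) * s) * (ν * (((m + 2 : ℕ) : ℝ) ^ 2 - (m + 2 : ℕ))))) s := by
        intro s
        have h1 : HasDerivAt (fun s => (s / 2) ^ (m + 1)) (((m + 1 : ℕ) : ℝ) * (s / 2) ^ m * (1 / 2)) s := by
          have := ((hasDerivAt_id s).div_const 2).fun_pow (m + 1)
          simp only [id_eq, Nat.add_sub_cancel] at this
          exact this
        have h2 : HasDerivAt (fun s => exp (ν * (((m + 2 : ℕ) : ℝ) ^ 2 - (m + 2 : ℕ)) * s))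
            (exp (ν * (((m + 2 : ℕ) : ℝ) ^ 2 - (m + 2 : ℕ)) * s) * (ν * (((m + 2 : ℕ) : ℝ) ^ 2 - (m + 2 : ℕ)))) s := by
          have := ((hasDerivAt_id s).const_mul (ν * (((m + 2 : ℕ) : ℝ) ^ 2 - (m + 2 : ℕ)))).exp
          simpa using this
        exact ((h1.const_mul (c ^ (m + 2))).mul h2)
      -- the inner convolution is bounded by (m+1)·(unweighted X)
      have hconv : ∀ s, 0 ≤ s →
          ∑ p ∈ antidiagonal (m + 2), e p.1 s * e p.2 s
            ≤ ((m + 1 : ℕ) : ℝ) * (c ^ (m + 2) * (s / 2) ^ m * exp (-(ν * ((m + 2 : ℕ) : ℝ) * s))) := by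
        intro s hs
        rw [conv_eq_inner_sum he (by omega) s, show m + 2 - 1 = m + 1 from rfl]
        have hterm : ∀ j ∈ range (m + 1), e (j + 1) s * e (m + 1 - j) s
            ≤ c ^ (m + 2) * (s / 2) ^ m * exp (-(ν * ((m + 2 : ℕ) : ℝ) * s)) := by
          intro j hj
          have hjm : j ≤ m := Nat.lt_succ_iff.mp (mem_range.mp hj)
          have ha := ih (j + 1) (by omega) (by omega) s hs
          have hb := ih (m + 1 - j) (by omega) (by omega) s hs
          have ha0 : 0 ≤ e (j + 1) s := nonneg he hc _ s hs
          have hb0 : 0 ≤ e (m + 1 - j) s := nonneg he hc _ s hs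
          have hprod := mul_le_mul ha hb hb0 (le_trans ha0 ha)
          refine le_trans hprod (le_of_eq ?_)
          have h1 : (j + 1 : ℕ) - 1 = j := rfl
          have h2 : (m + 1 - j : ℕ) - 1 = m - j := by omega
          rw [h1, h2]
          have hpow : (s / 2) ^ j * (s / 2) ^ (m - j) = (s / 2) ^ m := by
            rw [← pow_add, Nat.add_sub_cancel' hjm]
          have hcpow : c ^ (j + 1) * c ^ (m + 1 - j) = c ^ (m + 2) := by
            rw [← pow_add]; congr 1; omega
          have hexp : exp (-(ν * ((j + 1 : ℕ) : ℝ) * s)) * exp (-(ν * ((m + 1 - j : ℕ) : ℝ) * s))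
              = exp (-(ν * ((m + 2 : ℕ) : ℝ) * s)) := by
            rw [← exp_add]; congr 1
            have : ((m + 1 - j : ℕ) : ℝ) = (m : ℝ) + 1 - j := by
              rw [Nat.cast_sub (by omega)]; push_cast; ring
            rw [this]; push_cast; ring
          calc c ^ (j + 1) * (s / 2) ^ j * exp (-(ν * ((j + 1 : ℕ) : ℝ) * s))
                * (c ^ (m + 1 - j) * (s / 2) ^ (m - j) * exp (-(ν * ((m + 1 - j : ℕ) : ℝ) * s)))
              = (c ^ (j + 1) * c ^ (m + 1 - j)) * ((s / 2) ^ j * (s / 2) ^ (m - j))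
                * (exp (-(ν * ((j + 1 : ℕ) : ℝ) * s)) * exp (-(ν * ((m + 1 - j : ℕ) : ℝ) * s))) := by ring
            _ = c ^ (m + 2) * (s / 2) ^ m * exp (-(ν * ((m + 2 : ℕ) : ℝ) * s)) := by rw [hpow, hcpow, hexp]
        calc ∑ j ∈ range (m + 1), e (j + 1) s * e (m + 1 - j) s
            ≤ ∑ j ∈ range (m + 1), c ^ (m + 2) * (s / 2) ^ m * exp (-(ν * ((m + 2 : ℕ) : ℝ) * s)) := sum_le_sum hterm
          _ = ((m + 1 : ℕ) : ℝ) * (c ^ (m + 2) * (s / 2) ^ m * exp (-(ν * ((m + 2 : ℕ) : ℝ) * s))) := by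
            rw [sum_const, card_range, nsmul_eq_mul]
      -- ψ = W − D monotone on [0, ∞)
      set D : ℝ → ℝ := fun s => exp (ν * ((m + 2 : ℕ) : ℝ) ^ 2 * s) * e (m + 2) s with hD
      have hmono : MonotoneOn (fun s => W s - D s) (Ici 0) := by
        refine monotoneOn_of_hasDerivWithinAt_nonneg
          (f' := fun s => (c ^ (m + 2) * (((m + 1 : ℕ) : ℝ) * (s / 2) ^ m * (1 / 2))
              * exp (ν * (((m + 2 : ℕ) : ℝ) ^ 2 - (m + 2 : ℕ)) * s)
            + c ^ (m + 2) * (s / 2) ^ (m + 1)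
              * (exp (ν * (((m + 2 : ℕ) : ℝ) ^ 2 - (m + 2 : ℕ)) * s) * (ν * (((m + 2 : ℕ) : ℝ) ^ 2 - (m + 2 : ℕ)))))
            - exp (ν * ((m + 2 : ℕ) : ℝ) ^ 2 * s) * ((1 / 2) * ∑ p ∈ antidiagonal (m + 2), e p.1 s * e p.2 s))
          (convex_Ici 0) ?_ (fun s hs => ?_) (fun s hs => ?_)
        · refine ContinuousOn.sub (Continuous.continuousOn ?_) (continuousOn_weighted he (m + 2))
          exact ((continuous_const.mul ((continuous_id.div_const 2).pow _)).mul
            (continuous_exp.comp (continuous_const.mul continuous_id)))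
        · rw [interior_Ici] at hs ⊢
          exact ((hW' s).sub (hasDerivAt_weighted he (m + 2) hs)).hasDerivWithinAt
        · rw [interior_Ici] at hs
          have hs0 : 0 ≤ s := le_of_lt hs
          have hkk : 0 ≤ ν * (((m + 2 : ℕ) : ℝ) ^ 2 - (m + 2 : ℕ)) := by
            apply mul_nonneg hν; push_cast; nlinarith
          -- second term of W′ is ≥ 0; first term equals ½ e^{νk²s}·(m+1)·(...)
          have hsecond : 0 ≤ c ^ (m + 2) * (s / 2) ^ (m + 1)
              * (exp (ν * (((m + 2 : ℕ) : ℝ) ^ 2 - (m + 2 : ℕ)) * s) * (ν * (((m + 2 : ℕ) : ℝ) ^ 2 - (m + 2 : ℕ)))) := by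
            have : 0 ≤ s / 2 := by linarith
            positivity
          have hfirst : exp (ν * ((m + 2 : ℕ) : ℝ) ^ 2 * s) * ((1 / 2) * ∑ p ∈ antidiagonal (m + 2), e p.1 s * e p.2 s)
              ≤ c ^ (m + 2) * (((m + 1 : ℕ) : ℝ) * (s / 2) ^ m * (1 / 2))
                * exp (ν * (((m + 2 : ℕ) : ℝ) ^ 2 - (m + 2 : ℕ)) * s) := by
            have hc' := hconv s hs0
            have hE : 0 ≤ exp (ν * ((m + 2 : ℕ) : ℝ) ^ 2 * s) := (exp_pos _).le
            have hsplit : exp (ν * (((m + 2 : ℕ) : ℝ) ^ 2 - (m + 2 : ℕ)) * s)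
                = exp (ν * ((m + 2 : ℕ) : ℝ) ^ 2 * s) * exp (-(ν * ((m + 2 : ℕ) : ℝ) * s)) := by
              rw [← exp_add]; congr 1; ring
            rw [hsplit]
            have := mul_le_mul_of_nonneg_left hc' (mul_nonneg hE (by norm_num : (0:ℝ) ≤ 1 / 2))
            calc exp (ν * ((m + 2 : ℕ) : ℝ) ^ 2 * s) * ((1 / 2) * ∑ p ∈ antidiagonal (m + 2), e p.1 s * e p.2 s)
                = exp (ν * ((m + 2 : ℕ) : ℝ) ^ 2 * s) * (1 / 2) * ∑ p ∈ antidiagonal (m + 2), e p.1 s * e p.2 s := by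
                  ring
              _ ≤ exp (ν * ((m + 2 : ℕ) : ℝ) ^ 2 * s) * (1 / 2)
                  * (((m + 1 : ℕ) : ℝ) * (c ^ (m + 2) * (s / 2) ^ m * exp (-(ν * ((m + 2 : ℕ) : ℝ) * s)))) := this
              _ = c ^ (m + 2) * (((m + 1 : ℕ) : ℝ) * (s / 2) ^ m * (1 / 2))
                  * (exp (ν * ((m + 2 : ℕ) : ℝ) ^ 2 * s) * exp (-(ν * ((m + 2 : ℕ) : ℝ) * s))) := by ring
          linarith
      -- evaluate at 0 and conclude
      have hW0 : W 0 = 0 := by simp [hW]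
      have hD0 : D 0 = 0 := by simp [hD, he.init_zero (m + 2) (by omega)]
      have hψ := hmono (Set.self_mem_Ici) (show t ∈ Set.Ici (0:ℝ) from ht) ht
      simp only [hW0, hD0, sub_self] at hψ
      -- 0 ≤ W t − D t
      have hWt : W t = exp (ν * ((m + 2 : ℕ) : ℝ) ^ 2 * t)
          * (c ^ (m + 2) * (t / 2) ^ (m + 1) * exp (-(ν * ((m + 2 : ℕ) : ℝ) * t))) := by
        simp only [hW]
        have hsplit : exp (ν * (((m + 2 : ℕ) : ℝ) ^ 2 - (m + 2 : ℕ)) * t)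
            = exp (ν * ((m + 2 : ℕ) : ℝ) ^ 2 * t) * exp (-(ν * ((m + 2 : ℕ) : ℝ) * t)) := by
          rw [← exp_add]; congr 1; ring
        rw [hsplit]; ring
      have hineq : exp (ν * ((m + 2 : ℕ) : ℝ) ^ 2 * t) * e (m + 2) t
          ≤ exp (ν * ((m + 2 : ℕ) : ℝ) ^ 2 * t)
            * (c ^ (m + 2) * (t / 2) ^ (m + 1) * exp (-(ν * ((m + 2 : ℕ) : ℝ) * t))) := by
        rw [← hWt]; simpa [hD] using hψ
      exact le_of_mul_le_mul_left hineq (exp_pos _)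

/-- **EVERY MODE DECAYS INDIVIDUALLY**, for every `c ≥ 0` and `ν > 0`: `c_k(t) → 0` as `t → ∞` (`k ≥ 0`). On the torus the
finite-time blow-up of the companion file is therefore a loss of summability of `(c_k)_k`, never the growth of a single mode.
[new here — MODEL] -/
theorem tendsto_mode_zero (he : IsSineCascade ν c e) (hν : 0 < ν) (hc : 0 ≤ c) (k : ℕ) :
    Tendsto (e k) atTop (𝓝 0) := by
  rcases Nat.eq_zero_or_pos k with hk | hk
  · subst hk
    refine tendsto_const_nhds.congr' ?_
    exact Eventually.of_forall fun t => (he.zero t).symm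
  · -- squeeze between 0 and c^k (t/2)^{k-1} e^{-νkt}
    have hνk : 0 < ν * (k : ℝ) := mul_pos hν (by exact_mod_cast hk)
    -- g(x) = x^(k-1) e^{-x} → 0, composed with x = νk t
    have hg : Tendsto (fun t : ℝ => (ν * (k : ℝ) * t) ^ (k - 1) * exp (-(ν * (k : ℝ) * t))) atTop (𝓝 0) :=
      (tendsto_pow_mul_exp_neg_atTop_nhds_zero (k - 1)).comp (tendsto_id.const_mul_atTop hνk)
    have hmaj : Tendsto (fun t : ℝ => c ^ k * (t / 2) ^ (k - 1) * exp (-(ν * (k : ℝ) * t))) atTop (𝓝 0) := by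
      have heq : (fun t : ℝ => c ^ k * (t / 2) ^ (k - 1) * exp (-(ν * (k : ℝ) * t)))
          = fun t => (c ^ k * (1 / (2 * (ν * (k : ℝ)))) ^ (k - 1))
              * ((ν * (k : ℝ) * t) ^ (k - 1) * exp (-(ν * (k : ℝ) * t))) := by
        funext t
        have : t / 2 = (1 / (2 * (ν * (k : ℝ)))) * (ν * (k : ℝ) * t) := by
          field_simp
        rw [this, mul_pow]; ring
      rw [heq]
      simpa using hg.const_mul (c ^ k * (1 / (2 * (ν * (k : ℝ)))) ^ (k - 1))
    refine tendsto_of_tendsto_of_tendsto_of_le_of_le' tendsto_const_nhds hmaj ?_ ?_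
    · filter_upwards [eventually_ge_atTop (0 : ℝ)] with t ht using nonneg he hc k t ht
    · filter_upwards [eventually_ge_atTop (0 : ℝ)] with t ht using mode_le_sigmaOne he hν.le hc k hk t ht

/-- `ν t e^{−νt} ≤ e^{−1}`: the maximum of `x e^{−x}`. [folklore] -/
theorem mul_exp_neg_le (ν t : ℝ) : ν * t * exp (-(ν * t)) ≤ exp (-1) := by
  have h := add_one_le_exp (ν * t - 1)
  have h2 : ν * t * exp (-(ν * t)) = (ν * t - 1 + 1) * (exp (-1) * exp (-(ν * t - 1))) := by
    rw [← exp_add]; ring_nf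
  rw [h2]
  have h3 : (ν * t - 1 + 1) * exp (-(ν * t - 1)) ≤ 1 := by
    calc (ν * t - 1 + 1) * exp (-(ν * t - 1)) ≤ exp (ν * t - 1) * exp (-(ν * t - 1)) :=
          mul_le_mul_of_nonneg_right h (exp_pos _).le
      _ = 1 := by rw [← exp_add]; simp
  calc (ν * t - 1 + 1) * (exp (-1) * exp (-(ν * t - 1)))
      = exp (-1) * ((ν * t - 1 + 1) * exp (-(ν * t - 1))) := by ring
    _ ≤ exp (-1) * 1 := mul_le_mul_of_nonneg_left h3 (exp_pos _).le
    _ = exp (-1) := mul_one _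

/-- **SMALL SINE DATA ARE GLOBAL WITH A UNIFORM WIENER BOUND.** If `0 ≤ c < 2eν` then for every `K` and `t ≥ 0`:
`Σ_{k ≤ K} c_k(t) ≤ (2eνc/(2eν − c))·e^{−νt}` (all terms are `≥ 0`, so this bounds the `B₀` norm of every Galerkin
truncation uniformly, decaying at the rate of the first mode). Print: global existence for `‖ω₀‖_{B₀} < ν/4`
[cite: SilantyevLushnikovSiegelAmbrose2025, Thm 2.2]; here `2e ≈ 5.44` for sine data at `σ = 2`. [new here — MODEL] -/
theorem partialSum_le (he : IsSineCascade ν c e) (hν : 0 < ν) (hc : 0 ≤ c) (hsmall : c < 2 * exp 1 * ν)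
    (K : ℕ) (t : ℝ) (ht : 0 ≤ t) :
    ∑ k ∈ range (K + 1), e k t ≤ 2 * exp 1 * ν * c / (2 * exp 1 * ν - c) * exp (-(ν * t)) := by
  -- the ratio q = (c t / 2) e^{−νt} ≤ q₀ = c/(2eν) < 1
  set q : ℝ := c * (t / 2) * exp (-(ν * t)) with hq
  set q₀ : ℝ := c / (2 * exp 1 * ν) with hq₀
  have he1 : 0 < exp (1 : ℝ) := exp_pos 1
  have hq0 : 0 ≤ q := by positivity
  have hq₀0 : 0 ≤ q₀ := by positivity
  have hq₀1 : q₀ < 1 := by rw [hq₀, div_lt_one (by positivity)]; linarith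
  have hqq : q ≤ q₀ := by
    have h := mul_exp_neg_le ν t
    have hexp1 : exp (-1 : ℝ) = 1 / exp 1 := by rw [exp_neg]; ring
    rw [hq, hq₀]
    rw [hexp1] at h
    -- q = (c/(2ν)) · (ν t e^{−νt}) ≤ (c/(2ν)) · (1/e)
    have hν0 : ν ≠ 0 := hν.ne'
    have : c * (t / 2) * exp (-(ν * t)) = c / (2 * ν) * (ν * t * exp (-(ν * t))) := by
      field_simp
    rw [this]
    calc c / (2 * ν) * (ν * t * exp (-(ν * t))) ≤ c / (2 * ν) * (1 / exp 1) :=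
          mul_le_mul_of_nonneg_left h (by positivity)
      _ = c / (2 * exp 1 * ν) := by field_simp
  -- termwise: e_{k} ≤ c e^{−νt} q^{k−1} for k ≥ 1, e_0 = 0
  have hterm : ∀ k ∈ range K, e (k + 1) t ≤ c * exp (-(ν * t)) * q₀ ^ k := by
    intro k _
    have h := mode_le_sigmaOne he hν.le hc (k + 1) (by omega) t ht
    rw [show k + 1 - 1 = k from rfl] at h
    refine le_trans h ?_
    have hid : c ^ (k + 1) * (t / 2) ^ k * exp (-(ν * ((k + 1 : ℕ) : ℝ) * t)) = c * exp (-(ν * t)) * q ^ k := by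
      rw [hq, mul_pow, mul_pow, ← exp_nat_mul, pow_succ]
      have : exp (-(ν * ((k + 1 : ℕ) : ℝ) * t)) = exp (-(ν * t)) * exp ((k : ℕ) * -(ν * t)) := by
        rw [← exp_add]; congr 1; push_cast; ring
      rw [this]; ring
    rw [hid]
    exact mul_le_mul_of_nonneg_left (pow_le_pow_left₀ hq0 hqq k) (by positivity)
  -- sum the geometric majorant
  have hgeom : ∑ k ∈ range K, q₀ ^ k ≤ (1 - q₀)⁻¹ := by
    have hs : Summable (fun k : ℕ => q₀ ^ k) := summable_geometric_of_lt_one hq₀0 hq₀1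
    rw [← tsum_geometric_of_lt_one hq₀0 hq₀1]
    exact hs.sum_le_tsum (range K) (fun k _ => pow_nonneg hq₀0 k)
  rw [sum_range_succ', he.zero, add_zero]
  calc ∑ k ∈ range K, e (k + 1) t ≤ ∑ k ∈ range K, c * exp (-(ν * t)) * q₀ ^ k := sum_le_sum hterm
    _ = c * exp (-(ν * t)) * ∑ k ∈ range K, q₀ ^ k := by rw [mul_sum]
    _ ≤ c * exp (-(ν * t)) * (1 - q₀)⁻¹ := mul_le_mul_of_nonneg_left hgeom (by positivity)
    _ = 2 * exp 1 * ν * c / (2 * exp 1 * ν - c) * exp (-(ν * t)) := by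
      rw [hq₀]
      have h1 : 2 * exp 1 * ν - c ≠ 0 := by linarith
      have h2 : (2 * exp 1 * ν) ≠ 0 := by positivity
      field_simp

end SheetNSLineTorusCascade
end Summit.NavierStokesRegularity.OSWSelfSimilar
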